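import Literature.Probability.LatticeModels.LatticeHarmonicMeasure
import Literature.Probability.LatticeModels.RectangleExit
import HarnessLib

/-!
# Harmonic measure of the sides of a lattice rectangle seen from a point next to its base
# (Chelkak–Smirnov 2011, Lemma 3.12, on the square lattice)

Topic `Literature/Probability/LatticeModels` (discrete potential theory on `ℤ²`, continuing
`LatticeHarmonicMeasure.lean` and `RectangleExit.lean`). This is the elementary barrier lemma of
D. Chelkak, S. Smirnov, *Discrete complex analysis on isoradial graphs*, Adv. Math. 228 (2011),
§3.5, Lemma 3.12 (bib key `ChelkakSmirnov2011`), the technical input of their Theorem 3.13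
(convergence of the discrete Poisson kernel normalised at a boundary point; tree fact
`ChelkakSmirnov2011_boundaryNormalisedPoissonKernelLimit`, `FlatBoundaryPoissonKernelLimit.lean`),
specialised from isoradial graphs of mesh `δ` to `ℤ²` (mesh `1`; the general mesh is a rescaling):

> **Lemma 3.12.** Let `s ≥ 2t > 0`. If `δ` is small enough, then
> `ω^δ(o_int; U(s,t); R(s,t)) ≍ δ/t` and `ω^δ(o_int; V(s,t); R(s,t)) ≤ const · δ t / s²`,

where `R(s,t) = (-s, s) × (0, t)`, `U`, `V`, `L` are the upper, vertical and lower parts of its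
boundary and `o_int` is the interior vertex next to the boundary vertex closest to `0`. The printed
proof compares the harmonic measures with three quadratic harmonic polynomials `h₁ ≤ ω_U ≤ h₂`,
`ω_V ≤ h₃` ("Their restrictions on `Γ` are discrete harmonic due to Lemma 2.2 (i)" — on `ℤ²`:
`Δ X² = Δ Y² = 2`, affine functions are harmonic — and the maximum principle). Here, for the open
lattice rectangle `R = rectInterior a (2S) T = (a₀, a₀ + 2S) × (a₁, a₁ + T)` (`RectangleExit.lean`)
with coordinates `X = x₀ - a₀ - S ∈ (-S, S)`, `Y = x₁ - a₁ ∈ (0, T)`, we use the barriers cleared of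
denominators (exact boundary rows, so the paper's `t + 2δ` is just `T`):

* `csTopLowerNum = (S² - T²) Y + T (Y² - X²)`   (`= S² T · h₁`),
* `csTopUpperNum = (S² + T²) Y + T (X² - Y²)`   (`= S² T · h₂`),
* `csSideUpperNum = X² + Y (T - Y)`             (`= S² · h₃`),

all lattice-harmonic on `ℤ²` (`latticeLaplacian_csTopLowerNum` etc.), and prove, for the lattice
harmonic measure `latticeHM` of `LatticeHarmonicMeasure.lean` (top side `{x₁ = a₁ + T}`, vertical
sides `{x₀ = a₀} ∪ {x₀ = a₀ + 2S}`, base `{x₁ = a₁}`):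

* `csTopLowerNum_le`, `le_csTopUpperNum`, `le_csSideUpperNum` — the three pointwise comparisons on
  `R` (maximum principle `IsLatticeSubharmonicOn.le_of_forall_boundary_le`, frame analysis
  `frame_of_mem_latticeOuterBoundary`);
* `le_sides_latticeHM` — a harmonic function bounded by `M_U`, `M_V`, `M_L` on the three parts of
  the frame is bounded by `M_U ω_U + M_V ω_V + M_L ω_L` inside (the form in which the proof of
  Theorem 3.13 consumes the lemma: `Q^δ(o_int) = 0` against the side bounds);
* at the point `o = (a₀ + S, a₁ + 1)` next to the middle of the base:
  `1/T - T/S² ≤ ω_U(o) ≤ 1/T + T/S²` and `ω_V(o) ≤ T/S²` (`latticeHM_top_base_ge/le`,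
  `latticeHM_sides_base_le`), hence for `S ≥ 2T` the printed form
  `3/(4T) ≤ ω_U(o) ≤ 5/(4T)`, `ω_V(o) ≤ T/S²` (`chelkakSmirnov_lemma_3_12`);
* `top_ge_neg_of_squeeze`, `top_le_of_squeeze` — the **normalisation squeeze** at the end of the
  proof of Theorem 3.13: a harmonic `Q` on the rectangle (`S ≥ 2T`) vanishing at `o` and on the
  base, with `|Q| ≤ K` on the vertical sides, has top-side values reaching within `(4K/3) T²/S²`
  of `0` from both sides ("`|(μ−1)t + O(st) + o(1)| · δ/t ≤ const · δt/s²`").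

Everything is proved. Only the orientation "base below" is written out; the other three follow by
lattice motions (`IsLatticeMotion`, `BoxDirichlet.lean`) when needed. Not here: isoradial graphs,
and the rest of §3.5 (Theorem 3.13 itself needs the compactness/identification machinery of
Prop. 3.1, Thm. 3.8 and the continuum Poisson kernel).
-/

noncomputable section

namespace Literature.Probability.LatticeModels

open Set

/-! ### The three polynomial barriers -/

/-- `S² T · h₁` of Chelkak–Smirnov's proof of Lemma 3.12 on `ℤ²`, for the rectangle
`(a₀, a₀+2S) × (a₁, a₁+T)`: `(S² - T²) Y + T (Y² - X²)` with `X = x - a₀ - S`, `Y = y - a₁`.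
[cite: ChelkakSmirnov2011, proof of Lemma 3.12] -/
def csTopLowerNum (a : Site 2) (S T : ℕ) (x y : ℤ) : ℝ :=
  ((S : ℝ) ^ 2 - (T : ℝ) ^ 2) * ((y : ℝ) - a 1) +
    T * (((y : ℝ) - a 1) ^ 2 - ((x : ℝ) - a 0 - S) ^ 2)

/-- `S² T · h₂` of Chelkak–Smirnov's proof of Lemma 3.12 on `ℤ²`: `(S² + T²) Y + T (X² - Y²)`.
[cite: ChelkakSmirnov2011, proof of Lemma 3.12] -/
def csTopUpperNum (a : Site 2) (S T : ℕ) (x y : ℤ) : ℝ :=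
  ((S : ℝ) ^ 2 + (T : ℝ) ^ 2) * ((y : ℝ) - a 1) +
    T * (((x : ℝ) - a 0 - S) ^ 2 - ((y : ℝ) - a 1) ^ 2)

/-- `S² · h₃` of Chelkak–Smirnov's proof of Lemma 3.12 on `ℤ²`: `X² + Y (T - Y)`.
[cite: ChelkakSmirnov2011, proof of Lemma 3.12] -/
def csSideUpperNum (a : Site 2) (S T : ℕ) (x y : ℤ) : ℝ :=
  ((x : ℝ) - a 0 - S) ^ 2 + ((y : ℝ) - a 1) * ((T : ℝ) - ((y : ℝ) - a 1))

section Barriers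

variable (a : Site 2) (S T : ℕ)

/-- `h₁` is lattice-harmonic on all of `ℤ²` (`Δ Y = 0`, `Δ Y² = Δ X² = 2`).
[cite: ChelkakSmirnov2011, Lemma 2.2 (i)] -/
theorem latticeLaplacian_csTopLowerNum (v : Site 2) :
    latticeLaplacian (fun w => csTopLowerNum a S T (w 0) (w 1)) v = 0 := by
  rw [latticeLaplacian_coord (csTopLowerNum a S T)]
  simp only [csTopLowerNum]
  push_cast
  ring

/-- `h₂` is lattice-harmonic on all of `ℤ²`. [cite: ChelkakSmirnov2011, Lemma 2.2 (i)] -/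
theorem latticeLaplacian_csTopUpperNum (v : Site 2) :
    latticeLaplacian (fun w => csTopUpperNum a S T (w 0) (w 1)) v = 0 := by
  rw [latticeLaplacian_coord (csTopUpperNum a S T)]
  simp only [csTopUpperNum]
  push_cast
  ring

/-- `h₃` is lattice-harmonic on all of `ℤ²`. [cite: ChelkakSmirnov2011, Lemma 2.2 (i)] -/
theorem latticeLaplacian_csSideUpperNum (v : Site 2) :
    latticeLaplacian (fun w => csSideUpperNum a S T (w 0) (w 1)) v = 0 := by
  rw [latticeLaplacian_coord (csSideUpperNum a S T)]
  simp only [csSideUpperNum]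
  push_cast
  ring

end Barriers

/-! ### Comparison with the harmonic measures of the sides -/

variable {a : Site 2} {S T : ℕ}

/-- An everywhere-harmonic function minus a scalar multiple of a lattice harmonic measure is
harmonic on the (finite) set. [folklore] -/
theorem isLatticeHarmonicOn_sub_const_mul_latticeHM {R : Set (Site 2)} (hR : R.Finite)
    (B : Set (Site 2)) (c : ℝ) {P : Site 2 → ℝ} (hP : ∀ v, latticeLaplacian P v = 0) :
    IsLatticeHarmonicOn (fun w => P w - c * latticeHM R B w) R := by
  intro v hv
  rw [show (fun w => P w - c * latticeHM R B w) = P - (fun w => c * latticeHM R B w) from rfl,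
    latticeLaplacian_sub, latticeLaplacian_const_mul, latticeHM_harmonicOn hR B v hv, hP v]
  ring

/-- A scalar multiple of a lattice harmonic measure minus an everywhere-harmonic function is
harmonic on the (finite) set. [folklore] -/
theorem isLatticeHarmonicOn_const_mul_latticeHM_sub {R : Set (Site 2)} (hR : R.Finite)
    (B : Set (Site 2)) (c : ℝ) {P : Site 2 → ℝ} (hP : ∀ v, latticeLaplacian P v = 0) :
    IsLatticeHarmonicOn (fun w => c * latticeHM R B w - P w) R := by
  intro v hv
  rw [show (fun w => c * latticeHM R B w - P w) = (fun w => c * latticeHM R B w) - P from rfl,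
    latticeLaplacian_sub, latticeLaplacian_const_mul, latticeHM_harmonicOn hR B v hv, hP v]
  ring

/-- **`h₁ ≤ ω_U`** (Chelkak–Smirnov 2011, proof of Lemma 3.12, on `ℤ²`): on the open rectangle
`(a₀, a₀+2S) × (a₁, a₁+T)`, `(S² - T²) Y + T (Y² - X²) ≤ S² T · ω(·, top side)`.
[cite: ChelkakSmirnov2011, Lemma 3.12] -/
theorem csTopLowerNum_le (hT : 0 < T) {v : Site 2} (hv : v ∈ rectInterior a (2 * S) T) :
    csTopLowerNum a S T (v 0) (v 1) ≤
      (S : ℝ) ^ 2 * T * latticeHM (rectInterior a (2 * S) T) {w : Site 2 | w 1 = a 1 + T} v := by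
  have hR : (rectInterior a (2 * S) T).Finite := rectInterior_finite a (2 * S) T
  have hharm := isLatticeHarmonicOn_sub_const_mul_latticeHM hR {w : Site 2 | w 1 = a 1 + T}
    ((S : ℝ) ^ 2 * T) (latticeLaplacian_csTopLowerNum a S T)
  have hTr : (0 : ℝ) < T := by exact_mod_cast hT
  have key := hharm.subharmonicOn.le_of_forall_boundary_le hR (M := 0) ?_ v hv
  · linarith [key]
  intro w hw
  have hwR : w ∉ rectInterior a (2 * S) T := hw.1
  rcases frame_of_mem_latticeOuterBoundary hw with ⟨h0, h1, h2⟩ | ⟨h1 | h1, h0, h0'⟩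
  · -- vertical sides: `X² = S²`, `0 < Y < T`, `ω_U = 0`
    have hU : w ∉ {w : Site 2 | w 1 = a 1 + T} := by
      simp only [mem_setOf_eq]; omega
    rw [latticeHM_of_not_mem_of_not_mem hR hwR hU, mul_zero, sub_zero]
    have hY0 : (a 1 : ℝ) < w 1 := by exact_mod_cast h1
    have hYT : (w 1 : ℝ) < a 1 + T := by exact_mod_cast h2
    have hX : ((w 0 : ℝ) - a 0 - S) ^ 2 = (S : ℝ) ^ 2 := by
      rcases h0 with h0 | h0
      · rw [h0]; ring
      · rw [h0]; push_cast; ring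
    simp only [csTopLowerNum, hX]
    have hpos : (0 : ℝ) < (S : ℝ) ^ 2 + T * ((w 1 : ℝ) - a 1) := by positivity
    nlinarith [mul_pos (sub_pos.2 hYT) hpos]
  · -- base: `Y = 0`, `ω_U = 0`
    have hU : w ∉ {w : Site 2 | w 1 = a 1 + T} := by
      simp only [mem_setOf_eq]; omega
    rw [latticeHM_of_not_mem_of_not_mem hR hwR hU, mul_zero, sub_zero]
    have hY : (w 1 : ℝ) - a 1 = 0 := by rw [h1]; ring
    simp only [csTopLowerNum, hY]
    nlinarith [sq_nonneg ((w 0 : ℝ) - a 0 - S)]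
  · -- top: `Y = T`, `ω_U = 1`
    have hU : w ∈ {w : Site 2 | w 1 = a 1 + T} := by simpa only [mem_setOf_eq] using h1
    rw [latticeHM_of_not_mem_of_mem hR hwR hU, mul_one]
    have hY : (w 1 : ℝ) - a 1 = T := by rw [h1]; push_cast; ring
    simp only [csTopLowerNum, hY]
    nlinarith [sq_nonneg ((w 0 : ℝ) - a 0 - S)]

/-- **`ω_U ≤ h₂`** (Chelkak–Smirnov 2011, proof of Lemma 3.12, on `ℤ²`):
`S² T · ω(·, top side) ≤ (S² + T²) Y + T (X² - Y²)` on the open rectangle.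
[cite: ChelkakSmirnov2011, Lemma 3.12] -/
theorem le_csTopUpperNum (hT : 0 < T) {v : Site 2} (hv : v ∈ rectInterior a (2 * S) T) :
    (S : ℝ) ^ 2 * T * latticeHM (rectInterior a (2 * S) T) {w : Site 2 | w 1 = a 1 + T} v ≤
      csTopUpperNum a S T (v 0) (v 1) := by
  have hR : (rectInterior a (2 * S) T).Finite := rectInterior_finite a (2 * S) T
  have hharm := isLatticeHarmonicOn_const_mul_latticeHM_sub hR {w : Site 2 | w 1 = a 1 + T}
    ((S : ℝ) ^ 2 * T) (latticeLaplacian_csTopUpperNum a S T)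
  have hTr : (0 : ℝ) < T := by exact_mod_cast hT
  have key := hharm.subharmonicOn.le_of_forall_boundary_le hR (M := 0) ?_ v hv
  · linarith [key]
  intro w hw
  have hwR : w ∉ rectInterior a (2 * S) T := hw.1
  rcases frame_of_mem_latticeOuterBoundary hw with ⟨h0, h1, h2⟩ | ⟨h1 | h1, h0, h0'⟩
  · -- vertical sides
    have hU : w ∉ {w : Site 2 | w 1 = a 1 + T} := by
      simp only [mem_setOf_eq]; omega
    rw [latticeHM_of_not_mem_of_not_mem hR hwR hU, mul_zero, zero_sub, neg_nonpos]
    have hY0 : (a 1 : ℝ) < w 1 := by exact_mod_cast h1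
    have hYT : (w 1 : ℝ) < a 1 + T := by exact_mod_cast h2
    have hX : ((w 0 : ℝ) - a 0 - S) ^ 2 = (S : ℝ) ^ 2 := by
      rcases h0 with h0 | h0
      · rw [h0]; ring
      · rw [h0]; push_cast; ring
    simp only [csTopUpperNum, hX]
    nlinarith [mul_pos (sub_pos.2 hY0) (sub_pos.2 hYT), mul_pos hTr (sub_pos.2 hY0)]
  · -- base
    have hU : w ∉ {w : Site 2 | w 1 = a 1 + T} := by
      simp only [mem_setOf_eq]; omega
    rw [latticeHM_of_not_mem_of_not_mem hR hwR hU, mul_zero, zero_sub, neg_nonpos]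
    have hY : (w 1 : ℝ) - a 1 = 0 := by rw [h1]; ring
    simp only [csTopUpperNum, hY]
    nlinarith [sq_nonneg ((w 0 : ℝ) - a 0 - S)]
  · -- top
    have hU : w ∈ {w : Site 2 | w 1 = a 1 + T} := by simpa only [mem_setOf_eq] using h1
    rw [latticeHM_of_not_mem_of_mem hR hwR hU, mul_one, sub_nonpos]
    have hY : (w 1 : ℝ) - a 1 = T := by rw [h1]; push_cast; ring
    simp only [csTopUpperNum, hY]
    nlinarith [sq_nonneg ((w 0 : ℝ) - a 0 - S)]

/-- **`ω_V ≤ h₃`** (Chelkak–Smirnov 2011, proof of Lemma 3.12, on `ℤ²`):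
`S² · ω(·, vertical sides) ≤ X² + Y (T - Y)` on the open rectangle.
[cite: ChelkakSmirnov2011, Lemma 3.12] -/
theorem le_csSideUpperNum (hT : 0 < T) {v : Site 2} (hv : v ∈ rectInterior a (2 * S) T) :
    (S : ℝ) ^ 2 * latticeHM (rectInterior a (2 * S) T)
        {w : Site 2 | w 0 = a 0 ∨ w 0 = a 0 + 2 * S} v ≤
      csSideUpperNum a S T (v 0) (v 1) := by
  have hR : (rectInterior a (2 * S) T).Finite := rectInterior_finite a (2 * S) T
  have hharm := isLatticeHarmonicOn_const_mul_latticeHM_sub hR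
    {w : Site 2 | w 0 = a 0 ∨ w 0 = a 0 + 2 * S} ((S : ℝ) ^ 2) (latticeLaplacian_csSideUpperNum a S T)
  have hTr : (0 : ℝ) < T := by exact_mod_cast hT
  have key := hharm.subharmonicOn.le_of_forall_boundary_le hR (M := 0) ?_ v hv
  · linarith [key]
  intro w hw
  have hwR : w ∉ rectInterior a (2 * S) T := hw.1
  rcases frame_of_mem_latticeOuterBoundary hw with ⟨h0, h1, h2⟩ | ⟨h1 | h1, h0, h0'⟩
  · -- vertical sides: `ω_V = 1`
    have hV : w ∈ {w : Site 2 | w 0 = a 0 ∨ w 0 = a 0 + 2 * S} := by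
      simp only [mem_setOf_eq]; push_cast at h0; exact h0
    rw [latticeHM_of_not_mem_of_mem hR hwR hV, mul_one, sub_nonpos]
    have hY0 : (a 1 : ℝ) < w 1 := by exact_mod_cast h1
    have hYT : (w 1 : ℝ) < a 1 + T := by exact_mod_cast h2
    have hX : ((w 0 : ℝ) - a 0 - S) ^ 2 = (S : ℝ) ^ 2 := by
      rcases h0 with h0 | h0
      · rw [h0]; ring
      · rw [h0]; push_cast; ring
    simp only [csSideUpperNum, hX]
    nlinarith [mul_pos (sub_pos.2 hY0) (sub_pos.2 hYT)]
  · -- base: `ω_V = 0`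
    have hV : w ∉ {w : Site 2 | w 0 = a 0 ∨ w 0 = a 0 + 2 * S} := by
      simp only [mem_setOf_eq]; omega
    rw [latticeHM_of_not_mem_of_not_mem hR hwR hV, mul_zero, zero_sub, neg_nonpos]
    have hY : (w 1 : ℝ) - a 1 = 0 := by rw [h1]; ring
    simp only [csSideUpperNum, hY]
    nlinarith [sq_nonneg ((w 0 : ℝ) - a 0 - S)]
  · -- top: `ω_V = 0`
    have hV : w ∉ {w : Site 2 | w 0 = a 0 ∨ w 0 = a 0 + 2 * S} := by
      simp only [mem_setOf_eq]; omega
    rw [latticeHM_of_not_mem_of_not_mem hR hwR hV, mul_zero, zero_sub, neg_nonpos]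
    have hY : (w 1 : ℝ) - a 1 = T := by rw [h1]; push_cast; ring
    simp only [csSideUpperNum, hY]
    nlinarith [sq_nonneg ((w 0 : ℝ) - a 0 - S)]

/-- **Side-by-side bound for a harmonic function on the rectangle.** If `Q` is lattice-harmonic on
the open rectangle `(a₀, a₀+2S) × (a₁, a₁+T)`, `T > 0`, and `Q ≤ M_U` on the top side, `Q ≤ M_V`
on the two vertical sides and `Q ≤ M_L` on the base, then
`Q ≤ M_U ω_U + M_V ω_V + M_L ω_L` on the rectangle (comparison with the harmonic right-hand side;
the form used at `o_int` in the proof of Chelkak–Smirnov's Theorem 3.13).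
[cite: ChelkakSmirnov2011, proof of Thm. 3.13] -/
theorem le_sides_latticeHM (hT : 0 < T) {Q : Site 2 → ℝ}
    (hQ : IsLatticeHarmonicOn Q (rectInterior a (2 * S) T)) {MU MV ML : ℝ}
    (hU : ∀ w : Site 2, w 1 = a 1 + T → a 0 < w 0 → w 0 < a 0 + 2 * S → Q w ≤ MU)
    (hV : ∀ w : Site 2, (w 0 = a 0 ∨ w 0 = a 0 + 2 * S) → a 1 < w 1 → w 1 < a 1 + T → Q w ≤ MV)
    (hL : ∀ w : Site 2, w 1 = a 1 → a 0 < w 0 → w 0 < a 0 + 2 * S → Q w ≤ ML)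
    {v : Site 2} (hv : v ∈ rectInterior a (2 * S) T) :
    Q v ≤ MU * latticeHM (rectInterior a (2 * S) T) {w : Site 2 | w 1 = a 1 + T} v +
      MV * latticeHM (rectInterior a (2 * S) T) {w : Site 2 | w 0 = a 0 ∨ w 0 = a 0 + 2 * S} v +
      ML * latticeHM (rectInterior a (2 * S) T) {w : Site 2 | w 1 = a 1} v := by
  set R := rectInterior a (2 * S) T with hRdef
  have hR : R.Finite := rectInterior_finite a (2 * S) T
  set G : Site 2 → ℝ := fun w => MU * latticeHM R {w : Site 2 | w 1 = a 1 + T} w +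
      MV * latticeHM R {w : Site 2 | w 0 = a 0 ∨ w 0 = a 0 + 2 * S} w +
      ML * latticeHM R {w : Site 2 | w 1 = a 1} w with hG
  have hGsup : IsLatticeSuperharmonicOn G R := by
    intro w hw
    have e : G = (fun w => MU * latticeHM R {w : Site 2 | w 1 = a 1 + T} w) +
        (fun w => MV * latticeHM R {w : Site 2 | w 0 = a 0 ∨ w 0 = a 0 + 2 * S} w) +
        (fun w => ML * latticeHM R {w : Site 2 | w 1 = a 1} w) := by
      funext z; simp [hG]
    rw [e, latticeLaplacian_add, latticeLaplacian_add, latticeLaplacian_const_mul,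
      latticeLaplacian_const_mul, latticeLaplacian_const_mul, latticeHM_harmonicOn hR _ w hw,
      latticeHM_harmonicOn hR _ w hw, latticeHM_harmonicOn hR _ w hw]
    simp
  have key := le_of_sub_super_of_boundary hR hQ.subharmonicOn hGsup (c := 0) ?_ v hv
  · simpa [hG] using key
  intro w hw
  rw [add_zero]
  have hwR : w ∉ R := hw.1
  rcases frame_of_mem_latticeOuterBoundary hw with ⟨h0, h1, h2⟩ | ⟨h1 | h1, h0, h0'⟩
  · -- vertical sides: `G w = MV`
    have hVm : w ∈ {w : Site 2 | w 0 = a 0 ∨ w 0 = a 0 + 2 * S} := by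
      simp only [mem_setOf_eq]; push_cast at h0; exact h0
    have hUn : w ∉ {w : Site 2 | w 1 = a 1 + T} := by simp only [mem_setOf_eq]; omega
    have hLn : w ∉ {w : Site 2 | w 1 = a 1} := by simp only [mem_setOf_eq]; omega
    have hGw : G w = MV := by
      simp only [hG, latticeHM_of_not_mem_of_mem hR hwR hVm, latticeHM_of_not_mem_of_not_mem hR hwR hUn,
        latticeHM_of_not_mem_of_not_mem hR hwR hLn]
      ring
    rw [hGw]
    exact hV w (by push_cast at h0; exact h0) h1 h2
  · -- base: `G w = ML`
    have hVn : w ∉ {w : Site 2 | w 0 = a 0 ∨ w 0 = a 0 + 2 * S} := by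
      simp only [mem_setOf_eq]; omega
    have hUn : w ∉ {w : Site 2 | w 1 = a 1 + T} := by simp only [mem_setOf_eq]; omega
    have hLm : w ∈ {w : Site 2 | w 1 = a 1} := by simpa only [mem_setOf_eq] using h1
    have hGw : G w = ML := by
      simp only [hG, latticeHM_of_not_mem_of_not_mem hR hwR hVn, latticeHM_of_not_mem_of_not_mem hR hwR hUn,
        latticeHM_of_not_mem_of_mem hR hwR hLm]
      ring
    rw [hGw]
    exact hL w h1 h0 (by push_cast at h0'; exact h0')
  · -- top: `G w = MU`
    have hVn : w ∉ {w : Site 2 | w 0 = a 0 ∨ w 0 = a 0 + 2 * S} := by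
      simp only [mem_setOf_eq]; omega
    have hUm : w ∈ {w : Site 2 | w 1 = a 1 + T} := by simpa only [mem_setOf_eq] using h1
    have hLn : w ∉ {w : Site 2 | w 1 = a 1} := by simp only [mem_setOf_eq]; omega
    have hGw : G w = MU := by
      simp only [hG, latticeHM_of_not_mem_of_not_mem hR hwR hVn, latticeHM_of_not_mem_of_mem hR hwR hUm,
        latticeHM_of_not_mem_of_not_mem hR hwR hLn]
      ring
    rw [hGw]
    exact hU w h1 h0 (by push_cast at h0'; exact h0')

/-! ### At the point next to the middle of the base -/

/-- The point `o = (a₀ + S, a₁ + 1)` lies in the open rectangle `(a₀, a₀+2S) × (a₁, a₁+T)` as soon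
as `S ≥ 1`, `T ≥ 2`. [folklore] -/
theorem base_point_mem_rectInterior (hS : 0 < S) (hT : 2 ≤ T) {o : Site 2} (ho0 : o 0 = a 0 + S)
    (ho1 : o 1 = a 1 + 1) : o ∈ rectInterior a (2 * S) T := by
  simp only [rectInterior, mem_setOf_eq]
  push_cast
  omega

/-- **Lower bound `ω_U(o_int) ≥ 1/T - T/S²`** at the point next to the middle of the base
(Chelkak–Smirnov 2011, Lemma 3.12 on `ℤ²`, from `h₁(o) = S² - T² + T`).
[cite: ChelkakSmirnov2011, Lemma 3.12] -/
theorem latticeHM_top_base_ge (hS : 0 < S) (hT : 2 ≤ T) {o : Site 2} (ho0 : o 0 = a 0 + S)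
    (ho1 : o 1 = a 1 + 1) :
    1 / (T : ℝ) - T / (S : ℝ) ^ 2 ≤
      latticeHM (rectInterior a (2 * S) T) {w : Site 2 | w 1 = a 1 + T} o := by
  have hT0 : 0 < T := by omega
  have h := csTopLowerNum_le (a := a) hT0 (base_point_mem_rectInterior hS hT ho0 ho1)
  have hSr : (0 : ℝ) < S := by exact_mod_cast hS
  have hTr : (0 : ℝ) < T := by exact_mod_cast hT0
  have ho : csTopLowerNum a S T (o 0) (o 1) = (S : ℝ) ^ 2 - (T : ℝ) ^ 2 + T := by
    simp only [csTopLowerNum, ho0, ho1]; push_cast; ring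
  rw [ho] at h
  set ω := latticeHM (rectInterior a (2 * S) T) {w : Site 2 | w 1 = a 1 + T} o
  have hST : (0 : ℝ) < (S : ℝ) ^ 2 * T := by positivity
  rw [div_sub_div _ _ hTr.ne' (pow_pos hSr 2).ne', div_le_iff₀ (by positivity)]
  nlinarith [h]

/-- **Upper bound `ω_U(o_int) ≤ 1/T + T/S²`** at the point next to the middle of the base
(Chelkak–Smirnov 2011, Lemma 3.12 on `ℤ²`, from `h₂(o) = S² + T² - T`).
[cite: ChelkakSmirnov2011, Lemma 3.12] -/
theorem latticeHM_top_base_le (hS : 0 < S) (hT : 2 ≤ T) {o : Site 2} (ho0 : o 0 = a 0 + S)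
    (ho1 : o 1 = a 1 + 1) :
    latticeHM (rectInterior a (2 * S) T) {w : Site 2 | w 1 = a 1 + T} o ≤
      1 / (T : ℝ) + T / (S : ℝ) ^ 2 := by
  have hT0 : 0 < T := by omega
  have h := le_csTopUpperNum (a := a) hT0 (base_point_mem_rectInterior hS hT ho0 ho1)
  have hSr : (0 : ℝ) < S := by exact_mod_cast hS
  have hTr : (0 : ℝ) < T := by exact_mod_cast hT0
  have ho : csTopUpperNum a S T (o 0) (o 1) = (S : ℝ) ^ 2 + (T : ℝ) ^ 2 - T := by
    simp only [csTopUpperNum, ho0, ho1]; push_cast; ring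
  rw [ho] at h
  set ω := latticeHM (rectInterior a (2 * S) T) {w : Site 2 | w 1 = a 1 + T} o
  rw [div_add_div _ _ hTr.ne' (pow_pos hSr 2).ne', le_div_iff₀ (by positivity)]
  nlinarith [h]

/-- **Upper bound `ω_V(o_int) ≤ T/S²`** for the vertical sides at the point next to the middle of
the base (Chelkak–Smirnov 2011, Lemma 3.12 on `ℤ²`, from `h₃(o) = T - 1`).
[cite: ChelkakSmirnov2011, Lemma 3.12] -/
theorem latticeHM_sides_base_le (hS : 0 < S) (hT : 2 ≤ T) {o : Site 2} (ho0 : o 0 = a 0 + S)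
    (ho1 : o 1 = a 1 + 1) :
    latticeHM (rectInterior a (2 * S) T) {w : Site 2 | w 0 = a 0 ∨ w 0 = a 0 + 2 * S} o ≤
      T / (S : ℝ) ^ 2 := by
  have hT0 : 0 < T := by omega
  have h := le_csSideUpperNum (a := a) hT0 (base_point_mem_rectInterior hS hT ho0 ho1)
  have hSr : (0 : ℝ) < S := by exact_mod_cast hS
  have ho : csSideUpperNum a S T (o 0) (o 1) = (T : ℝ) - 1 := by
    simp only [csSideUpperNum, ho0, ho1]; push_cast; ring
  rw [ho] at h
  set ω := latticeHM (rectInterior a (2 * S) T) {w : Site 2 | w 0 = a 0 ∨ w 0 = a 0 + 2 * S} o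
  rw [le_div_iff₀ (by positivity)]
  nlinarith [h]

/-- **Chelkak–Smirnov 2011, Lemma 3.12 (square lattice, mesh `1`).** For the open lattice
rectangle `R = (a₀, a₀+2S) × (a₁, a₁+T)` with `S ≥ 2T`, `T ≥ 2`, and the interior point
`o = (a₀ + S, a₁ + 1)` next to the middle of its base: the harmonic measure of the top side seen
from `o` is `≍ 1/T` — precisely `3/(4T) ≤ ω_U(o) ≤ 5/(4T)` — and that of the two vertical sides is
`≤ T/S²` ("`ω^δ(o_int; U(s,t); R(s,t)) ≍ δ/t` and `ω^δ(o_int; V(s,t); R(s,t)) ≤ const · δt/s²`"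
with `δ = 1`, `s = S`, `t = T`, `const = 1`).
[cite: ChelkakSmirnov2011, Lemma 3.12] -/
theorem chelkakSmirnov_lemma_3_12 (hT : 2 ≤ T) (hST : 2 * T ≤ S) {o : Site 2}
    (ho0 : o 0 = a 0 + S) (ho1 : o 1 = a 1 + 1) :
    3 / (4 * (T : ℝ)) ≤ latticeHM (rectInterior a (2 * S) T) {w : Site 2 | w 1 = a 1 + T} o ∧
      latticeHM (rectInterior a (2 * S) T) {w : Site 2 | w 1 = a 1 + T} o ≤ 5 / (4 * (T : ℝ)) ∧
      latticeHM (rectInterior a (2 * S) T) {w : Site 2 | w 0 = a 0 ∨ w 0 = a 0 + 2 * S} o ≤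
        T / (S : ℝ) ^ 2 := by
  have hS : 0 < S := by omega
  have hSr : (0 : ℝ) < S := by exact_mod_cast hS
  have hTr : (0 : ℝ) < T := by exact_mod_cast (show 0 < T by omega)
  have hSTr : 2 * (T : ℝ) ≤ S := by exact_mod_cast hST
  -- `T/S² ≤ 1/(4T)` since `S ≥ 2T`
  have hkey : (T : ℝ) / (S : ℝ) ^ 2 ≤ 1 / (4 * T) := by
    rw [div_le_div_iff₀ (by positivity) (by positivity)]
    nlinarith [mul_le_mul hSTr hSTr (by positivity) hSr.le]
  refine ⟨?_, ?_, latticeHM_sides_base_le hS hT ho0 ho1⟩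
  · have h := latticeHM_top_base_ge (a := a) hS hT ho0 ho1
    have e : 3 / (4 * (T : ℝ)) = 1 / T - 1 / (4 * T) := by field_simp; ring
    rw [e]
    linarith
  · have h := latticeHM_top_base_le (a := a) hS hT ho0 ho1
    have e : 5 / (4 * (T : ℝ)) = 1 / T + 1 / (4 * T) := by field_simp; ring
    rw [e]
    linarith


/-! ### The normalisation squeeze of Theorem 3.13 -/

/-- **The normalisation squeeze** (Chelkak–Smirnov 2011, end of the proof of Thm. 3.13, on `ℤ²`):
let `Q` be lattice-harmonic on the open rectangle `(a₀, a₀+2S) × (a₁, a₁+T)`, `S ≥ 2T`, `T ≥ 2`,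
with `Q ≤ 0` on the base, `Q ≤ K` on the two vertical sides (`K ≥ 0`), `Q ≤ M` on the top side,
and `Q(o) = 0` at the point `o = (a₀ + S, a₁ + 1)` next to the middle of the base. Then
`M ≥ -(4K/3) · T²/S²`: by `le_sides_latticeHM`, `0 = Q(o) ≤ M ω_U(o) + K ω_V(o)` with
`ω_U(o) ≥ 3/(4T)` and `ω_V(o) ≤ T/S²` (Lemma 3.12). In the paper's notation
("the normalization `Q^δ(o_int) = 0` and Lemma 3.12 give
`|(μ−1)t + O(st) + o(1)| · δ/t ≤ const · δt/s²`"): `T = t/δ`, `S = s/δ`, `T²/S² = t²/s²`.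
Applied to `-Q` it bounds the top-side values from the other side (`top_ge_neg_of_squeeze'`).
[cite: ChelkakSmirnov2011, proof of Thm. 3.13] -/
theorem top_ge_neg_of_squeeze {a : Site 2} {S T : ℕ} (hT : 2 ≤ T) (hST : 2 * T ≤ S)
    {Q : Site 2 → ℝ} (hQ : IsLatticeHarmonicOn Q (rectInterior a (2 * S) T)) {M K : ℝ} (hK : 0 ≤ K)
    (hU : ∀ w : Site 2, w 1 = a 1 + T → a 0 < w 0 → w 0 < a 0 + 2 * S → Q w ≤ M)
    (hV : ∀ w : Site 2, (w 0 = a 0 ∨ w 0 = a 0 + 2 * S) → a 1 < w 1 → w 1 < a 1 + T → Q w ≤ K)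
    (hL : ∀ w : Site 2, w 1 = a 1 → a 0 < w 0 → w 0 < a 0 + 2 * S → Q w ≤ 0)
    {o : Site 2} (ho0 : o 0 = a 0 + S) (ho1 : o 1 = a 1 + 1) (hQo : Q o = 0) :
    -(4 * K / 3) * ((T : ℝ) ^ 2 / (S : ℝ) ^ 2) ≤ M := by
  have hS : 0 < S := by omega
  have hT0 : 0 < T := by omega
  have hTr : (0 : ℝ) < T := by exact_mod_cast hT0
  have hSr : (0 : ℝ) < S := by exact_mod_cast hS
  obtain ⟨hUge, -, hVle⟩ := chelkakSmirnov_lemma_3_12 (a := a) hT hST ho0 ho1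
  have key := le_sides_latticeHM (a := a) (S := S) (T := T) hT0 hQ (MU := M) (MV := K) (ML := 0) hU hV hL
    (base_point_mem_rectInterior hS hT ho0 ho1)
  rw [hQo, zero_mul, add_zero] at key
  set ωU := latticeHM (rectInterior a (2 * S) T) {w : Site 2 | w 1 = a 1 + T} o
  set ωV := latticeHM (rectInterior a (2 * S) T) {w : Site 2 | w 0 = a 0 ∨ w 0 = a 0 + 2 * S} o
  have hωV0 : 0 ≤ ωV := (latticeHM_mem_Icc (rectInterior_finite _ _ _) _ _).1
  by_cases hM : 0 ≤ M
  · have : 0 ≤ 4 * K / 3 * ((T : ℝ) ^ 2 / (S : ℝ) ^ 2) := by positivity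
    linarith
  · rw [not_le] at hM
    -- `0 ≤ M ωU + K ωV ≤ M · 3/(4T) + K · T/S²`
    have h1 : M * ωU ≤ M * (3 / (4 * T)) := mul_le_mul_of_nonpos_left hUge hM.le
    have h2 : K * ωV ≤ K * (T / (S : ℝ) ^ 2) := mul_le_mul_of_nonneg_left hVle hK
    have h3 : 0 ≤ M * (3 / (4 * T)) + K * (T / (S : ℝ) ^ 2) := by linarith
    -- multiply by `4T/3`
    have h4 : 0 ≤ M + 4 * K / 3 * ((T : ℝ) ^ 2 / (S : ℝ) ^ 2) := by
      have e : (4 * (T : ℝ) / 3) * (M * (3 / (4 * T)) + K * (T / (S : ℝ) ^ 2)) =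
          M + 4 * K / 3 * ((T : ℝ) ^ 2 / (S : ℝ) ^ 2) := by
        field_simp
      rw [← e]
      exact mul_nonneg (by positivity) h3
    linarith

/-- The normalisation squeeze from the other side: with `Q ≥ 0` on the base, `Q ≥ -K` on the
vertical sides and `Q ≥ m` on the top side, `Q(o) = 0` forces `m ≤ (4K/3) · T²/S²`.
[cite: ChelkakSmirnov2011, proof of Thm. 3.13] -/
theorem top_le_of_squeeze {a : Site 2} {S T : ℕ} (hT : 2 ≤ T) (hST : 2 * T ≤ S)
    {Q : Site 2 → ℝ} (hQ : IsLatticeHarmonicOn Q (rectInterior a (2 * S) T)) {m K : ℝ} (hK : 0 ≤ K)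
    (hU : ∀ w : Site 2, w 1 = a 1 + T → a 0 < w 0 → w 0 < a 0 + 2 * S → m ≤ Q w)
    (hV : ∀ w : Site 2, (w 0 = a 0 ∨ w 0 = a 0 + 2 * S) → a 1 < w 1 → w 1 < a 1 + T → -K ≤ Q w)
    (hL : ∀ w : Site 2, w 1 = a 1 → a 0 < w 0 → w 0 < a 0 + 2 * S → 0 ≤ Q w)
    {o : Site 2} (ho0 : o 0 = a 0 + S) (ho1 : o 1 = a 1 + 1) (hQo : Q o = 0) :
    m ≤ 4 * K / 3 * ((T : ℝ) ^ 2 / (S : ℝ) ^ 2) := by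
  have hnegQ : IsLatticeHarmonicOn (fun w => -Q w) (rectInterior a (2 * S) T) := fun w hw => by
    rw [show (fun w => -Q w) = -Q from rfl, latticeLaplacian_neg, hQ w hw, neg_zero]
  have h := top_ge_neg_of_squeeze (a := a) hT hST hnegQ (M := -m) (K := K) hK
    (fun w h1 h0 h0' => by linarith [hU w h1 h0 h0'])
    (fun w h0 h1 h1' => by linarith [hV w h0 h1 h1'])
    (fun w h1 h0 h0' => by linarith [hL w h1 h0 h0']) ho0 ho1 (by simp [hQo])
  linarith

end Literature.Probability.LatticeModels
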